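import Summits.HodgeConjecture.HodgeConjecture.Theorems.F0P3ClassificationEngineV8
import HarnessLib

/-!
# `F0P3ClassificationReadingV8` (T5-R, edition V8): KERNEL-CHECKED GLUE and THE COEFFICIENT READING BY FIBRE GROUPING — `|E| ≤ 1`, `E ≠ 0` only on the packet,
# `mult_eq_one_of_laws_grouped` ∕ `coefficientFormula_of_laws_grouped` (RULING (V43)(h-b); B-p08 (g20) ★ p823015 ported by the pen: no determination law), `mult_le_one_of_formula`

Theorems rendering (F0P3-plan RULINGS (V9)(b)∕(V12)∕(V41)∕(V43), F0P3-p03) of the T5 statement layer = dossier line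
`Cruxes/H413/Lines/F0_T5InnerFormClassification.lean` (v8 rf 3639e4bbb2677e64), split by topic into ★-importable modules (Theorems never import Lines):
(A) ★ `F0P3ClassificationKitV6` — frame, e.v.p. germs, the kit, pins (§0–§1.2 of the dossier, UNCHANGED at this edition, NOT re-filed; namespace `…V6`);
(B) `F0P3ClassificationLawsV8` — the named laws, their `.mono`, `structure Laws`, over the reducible alias `…V8.ClassificationKit := …V6.ClassificationKit`;
(C) `F0P3ClassificationEngineV8` — §1.4 the intermediate statements (14.6.2) ∕ coefficient formula and §2 the integrator's own mathematics, PROVED;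
(R) `F0P3ClassificationReadingV8` — `|E| ≤ 1` glue and the coefficient reading by fibre grouping (v7 §3); (D) `F0P3InnerFormClassificationV8` — the head `shape_of_T5`,
the kit-family composition `shapeGuarded_of_T5`.  EDITION V8 (namespace suffix `V8`; supersedes the V6 chain ★ p821941∕p822130∕p822263∕p822609 as the edition of record).
Declarations and proofs are BYTE-IDENTICAL to the dossier text (except the type-preserving header spellings marked `dedup.landed` below); only module docstrings, the namespace name, the kit alias + `open`s of the ★ kit edition,
a few one-line docstrings (Theorems lint) and the re-emitted `variable` blocks differ.  No `sorry`, no named fact, no instance, no notation.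

THIS MODULE: §3 of the dossier line (§3.1 `memberCoeff`∕`expansion` bounds, §3.2 the grouped coefficient reading, `mult_le_one_of_formula`), theorems only, kit-parametric.
HONEST LABEL: HC_CM is proved only modulo the printed citations until rung 0 closes.
-/

-- (no local instance attribute needed in this module: no `(𝔤,K)`-token binder is spelled here)

set_option autoImplicit false
set_option linter.dupNamespace false

-- Gate lint `dedup.landed` (header-text keyed): theorems whose header text coincides with a landed edition (v3.1 ∕ V5 ∕ V6 ∕ V7-B∕C) are written with
-- ONE binder's dot-notation expanded ∕ a numeral ascribed ∕ `≠` spelled `¬ … = …` — elaborated statements unchanged (F0P3-p03 (g7), 2026-08-31).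

noncomputable section

open NumberField IsDedekindDomain MeasureTheory
open scoped Matrix ComplexOrder BigOperators Classical

namespace Summit.HodgeConjecture.HodgeConjecture.Cruxes.H413.F0P3InnerFormClassificationV8

open Literature.NumberTheory.Rogawski1990 Literature.NumberTheory.GaloisRepresentations
open Literature.NumberTheory.Automorphic Literature.NumberTheory.Automorphic.UnitaryGroup
open Literature.NumberTheory.Automorphic.UnitaryGroup.CotangentForms
open Literature.RepresentationTheory.BorelWallach2000
open Literature.RepresentationTheory.KonnoKonno2007
open Summit.HodgeConjecture.HodgeConjecture.Cruxes.H413.F0P3InnerFormClassificationV6   -- ★ F0P3ClassificationKitV6: §0 frame abbreviations, §1 `Sockets`, the kit structure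
open Summit.HodgeConjecture.HodgeConjecture.Cruxes.H413.F0P3InnerFormClassificationV6.ClassificationKit   -- ★ §1.1 derived notation (`coordS`, `Adm`, `memberCoeff`, `expansion`), §1.2 `IsPinned`

/-! ## §3 KERNEL-CHECKED GLUE: the expansion coefficients take values in `{−1, 0, 1}`·½… — `|E| ≤ 1`, and `E ≠ 0` only on the packet -/

namespace ClassificationKit

variable {L : Type} [Field L] [NumberField L] [IsCMField L] {H : Matrix (Fin 3) (Fin 3) L} {ι : L →+* ℂ} {T : GL (Fin 3) ℂ}
  {hT : (T : Matrix (Fin 3) (Fin 3) ℂ)ᴴ * H.map ι * (T : Matrix (Fin 3) (Fin 3) ℂ) = Literature.Geometry.ComplexHyperbolic.BallModel.J}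
  {μ : Measure (Gp L H).automorphicQuotient} [(Gp L H).IsAutomorphicMeasure μ] (𝔠 : ClassificationKit L H ι T hT μ)

/-- `memberCoeff ∈ {0, 1, −1}` for `ε = ±1`. [cite: Rogawski1990, §14.6 p. 238] -/
theorem memberCoeff_mem {C : Type*} (Pk : LocalAPacket C) (ε : ℚ) (hε : ε = (1 : ℚ) ∨ ε = -1) (x : C) :
    memberCoeff Pk ε x = 0 ∨ memberCoeff Pk ε x = 1 ∨ memberCoeff Pk ε x = -1 := by
  unfold memberCoeff
  rcases hε with h | h <;> subst h <;> split_ifs <;> simp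

/-- A non-zero member coefficient sits on a packet member. [cite: Rogawski1990, §14.6 p. 238] -/
theorem memberCoeff_ne_zero {C : Type*} (Pk : LocalAPacket C) (ε : ℚ) (x : C) (h : ¬memberCoeff Pk ε x = 0) :
    x ∈ Pk.members := by
  unfold memberCoeff at h
  rw [LocalAPacket.mem_members_iff]
  by_contra hx
  push Not at hx
  rw [if_neg hx.1, if_neg hx.2] at h
  exact h rfl

/-- `|memberCoeff| ≤ 1` for `ε = ±1`. [cite: Rogawski1990, §14.6 p. 238] -/
theorem abs_memberCoeff_le {C : Type*} (Pk : LocalAPacket C) (ε : ℚ) (hε : ε = (1 : ℚ) ∨ ε = -1) (x : C) :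
    |memberCoeff Pk ε x| ≤ 1 := by
  rcases memberCoeff_mem Pk ε hε x with h | h | h <;> rw [h] <;> simp

/-- `|∏_v memberCoeff_v| ≤ 1` for `ε = ±1`. [cite: Rogawski1990, §14.6 p. 238] -/
theorem abs_prod_memberCoeff_le (ξ : OneDimAutRepH L) (S : Finset (Places L)) (ε : ℚ) (hε : ε = (1 : ℚ) ∨ ε = -1)
    (x : ∀ v : ↥S, IrrClass ((cmDatum L 3 H).Local v.1)) :
    |∏ v : ↥S, memberCoeff (𝔠.packFin ξ v.1) ε (x v)| ≤ 1 := by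
  rw [Finset.abs_prod]
  calc ∏ v : ↥S, |memberCoeff (𝔠.packFin ξ v.1) ε (x v)| ≤ ∏ v : ↥S, (1 : ℚ) :=
        Finset.prod_le_prod (fun _ _ => abs_nonneg _) fun v _ => abs_memberCoeff_le _ ε hε _
    _ = 1 := by simp

/-- `|E_ξ(x)| ≤ 1`. -/
theorem abs_expansion_le (ξ : OneDimAutRepH L) (S : Finset (Places L)) (hc : 𝔠.sgnG ξ = (1 : ℚ) ∨ 𝔠.sgnG ξ = -1) (x : LocS L H S) :
    |𝔠.expansion ξ S x| ≤ 1 := by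
  unfold expansion
  have hA : |memberCoeff (𝔠.packInf ξ) (-1) x.1 * ∏ v : ↥S, memberCoeff (𝔠.packFin ξ v.1) (-1) (x.2 v)| ≤ 1 := by
    rw [abs_mul]
    calc _ ≤ (1 : ℚ) * 1 := mul_le_mul (abs_memberCoeff_le _ _ (Or.inr rfl) _) (𝔠.abs_prod_memberCoeff_le ξ S _ (Or.inr rfl) _)
          (abs_nonneg _) zero_le_one
      _ = 1 := one_mul _
  have hB : |memberCoeff (𝔠.packInf ξ) 1 x.1 * ∏ v : ↥S, memberCoeff (𝔠.packFin ξ v.1) 1 (x.2 v)| ≤ 1 := by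
    rw [abs_mul]
    calc _ ≤ (1 : ℚ) * 1 := mul_le_mul (abs_memberCoeff_le _ _ (Or.inl rfl) _) (𝔠.abs_prod_memberCoeff_le ξ S _ (Or.inl rfl) _)
          (abs_nonneg _) zero_le_one
      _ = 1 := one_mul _
  have hc' : |𝔠.sgnG ξ| = 1 := by rcases hc with h | h <;> rw [h] <;> simp
  have hF : |(if 𝔠.cptXi ξ then (1 : ℚ) else 0)| ≤ 1 := by split_ifs <;> simp
  have hN : |((-1 : ℚ)) ^ 𝔠.N ξ| = 1 := by rw [abs_pow, abs_neg, abs_one, one_pow]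
  calc _ = |(if 𝔠.cptXi ξ then (1 : ℚ) else 0)| * (1 / 2) * |((-1 : ℚ)) ^ 𝔠.N ξ| *
            |memberCoeff (𝔠.packInf ξ) (-1) x.1 * ∏ v : ↥S, memberCoeff (𝔠.packFin ξ v.1) (-1) (x.2 v) +
              𝔠.sgnG ξ * (memberCoeff (𝔠.packInf ξ) 1 x.1 * ∏ v : ↥S, memberCoeff (𝔠.packFin ξ v.1) 1 (x.2 v))| := by
          rw [abs_mul, abs_mul, abs_mul]; norm_num
    _ ≤ 1 * (1 / 2) * 1 * (1 + 1) := by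
          rw [hN]
          refine mul_le_mul (mul_le_mul (mul_le_mul_of_nonneg_right hF (by norm_num)) le_rfl (by positivity) (by positivity)) ?_
            (abs_nonneg _) (by positivity)
          calc _ ≤ |memberCoeff (𝔠.packInf ξ) (-1) x.1 * ∏ v : ↥S, memberCoeff (𝔠.packFin ξ v.1) (-1) (x.2 v)| +
                    |𝔠.sgnG ξ * (memberCoeff (𝔠.packInf ξ) 1 x.1 * ∏ v : ↥S, memberCoeff (𝔠.packFin ξ v.1) 1 (x.2 v))| := abs_add_le _ _
            _ ≤ 1 + 1 := by
                  refine add_le_add hA ?_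
                  rw [abs_mul, hc', one_mul]; exact hB
    _ = 1 := by norm_num

/-- `E_ξ(x) ≠ 0 ⇒` every coordinate of `x` lies in its packet. -/
theorem coords_mem_of_expansion_ne_zero (ξ : OneDimAutRepH L) (S : Finset (Places L)) (x : LocS L H S) (h : ¬𝔠.expansion ξ S x = 0) :
    x.1 ∈ (𝔠.packInf ξ).members ∧ 𝔠.cptXi ξ ∧ ∀ v : ↥S, x.2 v ∈ (𝔠.packFin ξ v.1).members := by
  unfold expansion at h
  refine ⟨?_, ?_, fun v => ?_⟩
  · by_contra hx
    have h1 : memberCoeff (𝔠.packInf ξ) (-1) x.1 = 0 := by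
      by_contra h1; exact hx (memberCoeff_ne_zero _ _ _ h1)
    have h2 : memberCoeff (𝔠.packInf ξ) 1 x.1 = 0 := by
      by_contra h2; exact hx (memberCoeff_ne_zero _ _ _ h2)
    rw [h1, h2] at h; simp at h
  · by_contra hF; rw [if_neg hF] at h; simp at h
  · by_contra hx
    have h1 : memberCoeff (𝔠.packFin ξ v.1) (-1) (x.2 v) = 0 := by
      by_contra h1; exact hx (memberCoeff_ne_zero _ _ _ h1)
    have h2 : memberCoeff (𝔠.packFin ξ v.1) 1 (x.2 v) = 0 := by
      by_contra h2; exact hx (memberCoeff_ne_zero _ _ _ h2)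
    have p1 : ∏ w : ↥S, memberCoeff (𝔠.packFin ξ w.1) (-1) (x.2 w) = 0 := Finset.prod_eq_zero (Finset.mem_univ v) h1
    have p2 : ∏ w : ↥S, memberCoeff (𝔠.packFin ξ w.1) 1 (x.2 w) = 0 := Finset.prod_eq_zero (Finset.mem_univ v) h2
    rw [p1, p2] at h; simp at h

/-! ### §3.2 THE COEFFICIENT READING BY FIBRE GROUPING (v7, RULING (V43)(h-b); B-p08 (g20) ★ p823015, ported) — no determination law -/

/-- **A unitary coordinate is SEEN by some test function**: (L2) `LinIndepS` applied to the indicator of `x`. [cite: Rogawski1990, Prop. 13.8.1 p. 206] -/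
theorem exists_chS_ne_zero_of_unitaryLoc (h6 : ClassificationKit.LinIndepS 𝔠) (S : Finset (Places L)) (x : LocS L H S) (hx : 𝔠.UnitaryLoc S x) :
    ∃ fS : 𝔠.TestS S, 𝔠.chS S x fS ≠ 0 := by
  classical
  by_contra hno
  push Not at hno
  have hsupp : ∀ (fS : 𝔠.TestS S) (y : LocS L H S), y ≠ x → (if y = x then (1 : ℂ) else 0) * 𝔠.chS S y fS = 0 := fun fS y hy => by
    rw [if_neg hy, zero_mul]
  have h := h6 S (fun y => if y = x then (1 : ℂ) else 0)
    (fun y hy => by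
      by_cases hyx : y = x
      · rw [hyx]; exact hx
      · exact absurd (if_neg hyx) hy)
    (fun fS => summable_of_ne_finset_zero (s := {x}) fun y hy => hsupp fS y (by simpa only [Finset.mem_singleton] using hy))
    (fun fS => by rw [tsum_eq_single x (hsupp fS), if_pos rfl, one_mul, hno fS]) x
  rw [if_pos rfl] at h
  exact one_ne_zero h

/-- **Z10a (v7) — THE COEFFICIENT READING BY FIBRE GROUPING** [Rogawski1990 p. 238 l. 11 – p. 239 l. 4; Prop. 13.8.1 p. 206]: in the germ of `t(Π(ξ))` off
`S ⊇ ram ξ`, an Adm class `c₀` of POSITIVE multiplicity has `mult c₀ = 1 = E_ξ(coordS S c₀)` — from (14.6.2) per germ (`PerClassIdentity`), the transfer of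
test functions (`TransferS`), linear independence of characters on unitary coordinates (`LinIndepS`, `UnitaryCoord`, `UnitaryPacket`), the A-class spectral data and
the local expansion at `ξ`; NO determination law (v6's (L7)∕(L7′) deleted, RULING (V43)(h-b); B-p08 (g20) ★ p823015 ported).  The class side, restricted to classes of
positive multiplicity (the others contribute `0`), is REGROUPED by the fibres of `κ : c ↦ coordS S c` (`HasSum.sigma`): every fibre is FINITE (a unitary point is seen
by a test function; the summable class family has terms of norm `≥ ‖ch_x(f_S)‖ > 0` on the fibre), `m(x) := Σ_{κ c = x} mult c` satisfies `m = E_ξ` pointwise by (L2),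
and `|E_ξ| ≤ 1 ≤ mult c₀ ≤ m(κ c₀)` (★ `abs_expansion_le`) gives `mult c₀ = 1 = E_ξ(κ c₀)`. [cite: Rogawski1990, §14.6 pp. 238–239 and Prop. 13.8.1] -/
theorem mult_eq_one_of_laws_grouped
    {S₀ : Finset (Places L)}
    (h0 : ClassificationKit.PerClassIdentity 𝔠 S₀) (hT : 𝔠.TransferS S₀) (h6 : 𝔠.LinIndepS) (h6a : 𝔠.UnitaryCoord) (h6b : 𝔠.UnitaryPacket S₀)
    (h8 : 𝔠.APacketSpectral S₀) (h9 : 𝔠.LocalExpansion S₀)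
    (ξ : OneDimAutRepH L) (S : Finset (Places L)) (hS₀ : S₀ ⊆ S) (hS : 𝔠.ram ξ ⊆ S) (c₀ : 𝔠.Cls) (hc₀ : EqOff L H S (𝔠.evp c₀) (𝔠.tXi ξ)) (hr₀ : 𝔠.Adm S c₀)
    (hm₀ : 1 ≤ 𝔠.mult c₀) :
    𝔠.mult c₀ = 1 ∧ 𝔠.expansion ξ S (𝔠.coordS S c₀) = 1 := by
  classical
  -- the fibre of the germ of `t(Π(ξ))` among Adm classes (the index of (14.6.2)'s class side), its sub-fibre of POSITIVE multiplicity, and the coordinate map `κ`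
  let F₀ : 𝔠.Cls → Prop := fun c => germ L H S (𝔠.evp c) = germ L H S (𝔠.tXi ξ) ∧ 𝔠.Adm S c
  let Fp : 𝔠.Cls → Prop := fun c => F₀ c ∧ 1 ≤ 𝔠.mult c
  let j : {c : 𝔠.Cls // Fp c} → {c : 𝔠.Cls // F₀ c} := fun c => ⟨c.1, c.2.1⟩
  have hj : Function.Injective j := fun a b h => Subtype.ext (by have h' := congrArg Subtype.val h; exact h')
  let κ : {c : 𝔠.Cls // Fp c} → LocS L H S := fun c => 𝔠.coordS S c.1
  have hκ : ∀ c : {c : 𝔠.Cls // Fp c}, κ c = 𝔠.coordS S c.1 := fun _ => rfl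
  -- the tested identity over the positive-multiplicity fibre, for every `fS`
  have key : ∀ fS : 𝔠.TestS S,
      Summable (fun c : {c : 𝔠.Cls // Fp c} => (𝔠.mult c.1 : ℂ) * 𝔠.chS S (κ c) fS) ∧
      (Function.support fun x : LocS L H S => (𝔠.expansion ξ S x : ℂ) * 𝔠.chS S x fS).Finite ∧
      ∑' c : {c : 𝔠.Cls // Fp c}, (𝔠.mult c.1 : ℂ) * 𝔠.chS S (κ c) fS = ∑ᶠ x, (𝔠.expansion ξ S x : ℂ) * 𝔠.chS S x fS := by
    intro fS
    obtain ⟨fSG, fSH, hM⟩ := hT S hS₀ fS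
    obtain ⟨hsc, -, -, hid⟩ := h0 S (germ L H S (𝔠.tXi ξ)) fS fSG fSH hS₀ hM
    obtain ⟨-, -, -, -, hAP⟩ := h8 ξ S hS₀ hS
    obtain ⟨hQ, hρ⟩ := hAP fSG fSH
    obtain ⟨hfin, hloc⟩ := (h9 ξ S hS₀ hS).2 fS fSG fSH hM
    -- the terms of (14.6.2)'s class side vanish off the positive-multiplicity sub-fibre
    have hsupp : (Function.support fun b : {c : 𝔠.Cls // F₀ c} => (𝔠.mult b.1 : ℂ) * 𝔠.chS S (𝔠.coordS S b.1) fS) ⊆ Set.range j := by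
      intro b hb
      have hm : 𝔠.mult b.1 ≠ 0 := by
        intro h0'
        apply hb
        change (𝔠.mult b.1 : ℂ) * 𝔠.chS S (𝔠.coordS S b.1) fS = 0
        rw [h0', Nat.cast_zero, zero_mul]
      exact ⟨⟨b.1, b.2, Nat.one_le_iff_ne_zero.2 hm⟩, Subtype.ext rfl⟩
    have hcomp : ((fun b : {c : 𝔠.Cls // F₀ c} => (𝔠.mult b.1 : ℂ) * 𝔠.chS S (𝔠.coordS S b.1) fS) ∘ j) =
        fun c : {c : 𝔠.Cls // Fp c} => (𝔠.mult c.1 : ℂ) * 𝔠.chS S (κ c) fS := by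
      funext c
      rfl
    refine ⟨hcomp ▸ hsc.comp_injective hj, hfin, ?_⟩
    calc ∑' c : {c : 𝔠.Cls // Fp c}, (𝔠.mult c.1 : ℂ) * 𝔠.chS S (κ c) fS
        = ∑' c : {c : 𝔠.Cls // Fp c}, (fun b : {c : 𝔠.Cls // F₀ c} => (𝔠.mult b.1 : ℂ) * 𝔠.chS S (𝔠.coordS S b.1) fS) (j c) := by
          rw [← hcomp]
      _ = ∑' b : {c : 𝔠.Cls // F₀ c}, (𝔠.mult b.1 : ℂ) * 𝔠.chS S (𝔠.coordS S b.1) fS := hj.tsum_eq hsupp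
      _ = _ := by rw [hid, hQ, hρ, hloc]
  -- every fibre of `κ` is FINITE
  have hfinite : ∀ x : LocS L H S, Finite {c : {c : 𝔠.Cls // Fp c} // κ c = x} := by
    intro x
    by_cases hne : Nonempty {c : {c : 𝔠.Cls // Fp c} // κ c = x}
    · obtain ⟨⟨c₁, hc₁⟩⟩ := hne
      have hxu : 𝔠.UnitaryLoc S x := by rw [← hc₁, hκ]; exact h6a S c₁.1
      obtain ⟨fS, hfS⟩ := 𝔠.exists_chS_ne_zero_of_unitaryLoc h6 S x hxu
      obtain ⟨hsc, -, -⟩ := key fS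
      -- the restriction of the summable class family to the fibre has terms of norm `≥ ‖ch_S(x)(fS)‖ > 0`
      have hsub : Summable (fun c : {c : {c : 𝔠.Cls // Fp c} // κ c = x} => (𝔠.mult c.1.1 : ℂ) * 𝔠.chS S (κ c.1) fS) :=
        hsc.comp_injective Subtype.val_injective
      have hlim := hsub.tendsto_cofinite_zero
      rw [NormedAddGroup.tendsto_nhds_zero] at hlim
      have hev := hlim ‖𝔠.chS S x fS‖ (norm_pos_iff.2 hfS)
      rw [Filter.eventually_cofinite] at hev
      have huniv : {c : {c : {c : 𝔠.Cls // Fp c} // κ c = x} | ¬ ‖(𝔠.mult c.1.1 : ℂ) * 𝔠.chS S (κ c.1) fS‖ < ‖𝔠.chS S x fS‖} = Set.univ := by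
        refine Set.eq_univ_of_forall fun c => ?_
        simp only [Set.mem_setOf_eq, not_lt, c.2, norm_mul, Complex.norm_natCast]
        have h1 : (1 : ℝ) ≤ (𝔠.mult c.1.1 : ℝ) := by exact_mod_cast c.1.2.2
        nlinarith [norm_nonneg (𝔠.chS S x fS)]
      rw [huniv] at hev
      exact Set.finite_univ_iff.1 hev
    · exact ⟨fun c => (hne ⟨c⟩).elim, fun i => i.elim0, fun c => (hne ⟨c⟩).elim, fun i => i.elim0⟩
  haveI : ∀ x : LocS L H S, Fintype {c : {c : 𝔠.Cls // Fp c} // κ c = x} := fun x => Fintype.ofFinite _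
  -- the grouped multiplicity function `m x := Σ_{κ c = x} mult c`
  let m : LocS L H S → ℂ := fun x => ∑ c : {c : {c : 𝔠.Cls // Fp c} // κ c = x}, (𝔠.mult c.1.1 : ℂ)
  -- regrouping the class sum by the fibres of `κ`
  have grouped : ∀ fS : 𝔠.TestS S, HasSum (fun x => m x * 𝔠.chS S x fS)
      (∑' c : {c : 𝔠.Cls // Fp c}, (𝔠.mult c.1 : ℂ) * 𝔠.chS S (κ c) fS) := by
    intro fS
    obtain ⟨hsc, -, -⟩ := key fS
    have ha : HasSum ((fun c : {c : 𝔠.Cls // Fp c} => (𝔠.mult c.1 : ℂ) * 𝔠.chS S (κ c) fS) ∘ Equiv.sigmaFiberEquiv κ)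
        (∑' c : {c : 𝔠.Cls // Fp c}, (𝔠.mult c.1 : ℂ) * 𝔠.chS S (κ c) fS) :=
      (Equiv.hasSum_iff (Equiv.sigmaFiberEquiv κ)).2 hsc.hasSum
    refine ha.sigma fun x => ?_
    have heq : (fun c : {c : {c : 𝔠.Cls // Fp c} // κ c = x} =>
        ((fun c : {c : 𝔠.Cls // Fp c} => (𝔠.mult c.1 : ℂ) * 𝔠.chS S (κ c) fS) ∘ Equiv.sigmaFiberEquiv κ) ⟨x, c⟩) =
        fun c => (𝔠.mult c.1.1 : ℂ) * 𝔠.chS S x fS := by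
      funext c
      simp only [Function.comp_apply, Equiv.sigmaFiberEquiv_apply, c.2]
    rw [heq, show m x * 𝔠.chS S x fS = ∑ c : {c : {c : 𝔠.Cls // Fp c} // κ c = x}, (𝔠.mult c.1.1 : ℂ) * 𝔠.chS S x fS by
      rw [Finset.sum_mul]]
    exact hasSum_fintype _
  -- linear independence (L2) applied to `m − E_ξ`, supported on unitary coordinates
  have hb : ∀ x : LocS L H S, m x - (𝔠.expansion ξ S x : ℂ) = 0 := by
    refine h6 S (fun x => m x - (𝔠.expansion ξ S x : ℂ)) ?_ ?_ ?_
    · intro x hx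
      by_cases hEx : 𝔠.expansion ξ S x = 0
      · have hmx : m x ≠ 0 := by
          intro h; apply hx; rw [h, hEx, Rat.cast_zero, sub_zero]
        have hne : Nonempty {c : {c : 𝔠.Cls // Fp c} // κ c = x} := by
          by_contra h
          apply hmx
          haveI : IsEmpty {c : {c : 𝔠.Cls // Fp c} // κ c = x} := not_nonempty_iff.1 h
          exact Finset.sum_of_isEmpty _
        obtain ⟨⟨c₁, hc₁⟩⟩ := hne
        rw [← hc₁, hκ]
        exact h6a S c₁.1
      · exact h6b ξ S x hS₀ hS hEx
    · intro fS
      obtain ⟨-, hfin, -⟩ := key fS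
      simpa only [sub_mul] using (grouped fS).summable.sub (summable_of_hasFiniteSupport hfin)
    · intro fS
      obtain ⟨-, hfin, hid⟩ := key fS
      simp only [sub_mul]
      rw [(grouped fS).summable.tsum_sub (summable_of_hasFiniteSupport hfin), (grouped fS).tsum_eq, hid, tsum_eq_finsum hfin, sub_self]
  -- read the coefficient at `c₀`: the fibre sum `s = Σ_{κ c = κ c₀} mult c` satisfies `mult c₀ ≤ s = E_ξ ≤ 1 ≤ mult c₀`
  have hc₀F : Fp c₀ := ⟨⟨(germ_eq_germ_iff L H S _ _).2 hc₀, hr₀⟩, hm₀⟩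
  have hmE : m (𝔠.coordS S c₀) = (𝔠.expansion ξ S (𝔠.coordS S c₀) : ℂ) := sub_eq_zero.1 (hb _)
  set s : ℕ := ∑ c : {c : {c : 𝔠.Cls // Fp c} // κ c = 𝔠.coordS S c₀}, 𝔠.mult c.1.1 with hsdef
  have hms : m (𝔠.coordS S c₀) = (s : ℂ) := by rw [hsdef, Nat.cast_sum]
  have hsE : (s : ℚ) = 𝔠.expansion ξ S (𝔠.coordS S c₀) := by
    have h : ((s : ℚ) : ℂ) = ((𝔠.expansion ξ S (𝔠.coordS S c₀) : ℚ) : ℂ) := by rw [Rat.cast_natCast, ← hms, hmE]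
    exact_mod_cast h
  have hs1 : s ≤ 1 := by
    have h : (s : ℚ) ≤ 1 := hsE ▸ (le_abs_self _).trans (𝔠.abs_expansion_le ξ S (h9 ξ S hS₀ hS).1 _)
    exact_mod_cast h
  let e₀ : {c : {c : 𝔠.Cls // Fp c} // κ c = 𝔠.coordS S c₀} := ⟨⟨c₀, hc₀F⟩, rfl⟩
  have hc₀s : 𝔠.mult c₀ ≤ s :=
    Finset.single_le_sum (f := fun c : {c : {c : 𝔠.Cls // Fp c} // κ c = 𝔠.coordS S c₀} => 𝔠.mult c.1.1) (fun _ _ => Nat.zero_le _)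
      (Finset.mem_univ e₀)
  have hm₁ : 𝔠.mult c₀ = 1 := le_antisymm (hc₀s.trans hs1) hm₀
  have hs : s = 1 := le_antisymm hs1 (hm₀.trans hc₀s)
  exact ⟨hm₁, by exact_mod_cast (hs ▸ hsE).symm⟩

/-- **Z10a (v7) — `CoefficientFormula` AS STATED** (classes of positive multiplicity), from the laws WITHOUT any determination law. [cite: Rogawski1990, §14.6 pp. 238–239 and Prop. 13.8.1] -/
theorem coefficientFormula_of_laws_grouped
    {S₀ : Finset (Places L)}
    (h0 : ClassificationKit.PerClassIdentity 𝔠 S₀) (hT : 𝔠.TransferS S₀) (h6 : 𝔠.LinIndepS) (h6a : 𝔠.UnitaryCoord) (h6b : 𝔠.UnitaryPacket S₀)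
    (h8 : 𝔠.APacketSpectral S₀) (h9 : 𝔠.LocalExpansion S₀) :
    𝔠.CoefficientFormula S₀ := by
  intro ξ S hS₀ hS c₀ hc₀ hr₀ hm₀
  obtain ⟨hm, hE⟩ := 𝔠.mult_eq_one_of_laws_grouped h0 hT h6 h6a h6b h8 h9 ξ S hS₀ hS c₀ hc₀ hr₀ hm₀
  rw [hm, hE, Nat.cast_one]

/-- From the coefficient formula: `m ≤ 1`, and `m ≠ 0 ⇒` coordinates in the packets (v7: for a class of positive multiplicity). -/
theorem mult_le_one_of_formula {S₀ : Finset (Places L)} (hL : 𝔠.LocalExpansion S₀) (hC : 𝔠.CoefficientFormula S₀) (ξ : OneDimAutRepH L) (S : Finset (Places L))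
    (hS₀ : S₀ ⊆ S) (hS : 𝔠.ram ξ ⊆ S)
    (c : 𝔠.Cls) (hc : EqOff L H S (𝔠.evp c) (𝔠.tXi ξ)) (hr : 𝔠.Adm S c) (hm1 : 1 ≤ 𝔠.mult c) :
    𝔠.mult c ≤ 1 ∧ (𝔠.mult c ≠ 0 →
      𝔠.clInf c ∈ (𝔠.packInf ξ).members ∧ 𝔠.cptXi ξ ∧ ∀ v : ↥S, 𝔠.clFin c v.1 ∈ (𝔠.packFin ξ v.1).members) := by
  have hform := hC ξ S hS₀ hS c hc hr hm1
  have habs := 𝔠.abs_expansion_le ξ S (hL ξ S hS₀ hS).1 (𝔠.coordS S c)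
  rw [← hform] at habs
  refine ⟨?_, fun hm => ?_⟩
  · have : (𝔠.mult c : ℚ) ≤ 1 := (le_abs_self _).trans habs
    exact_mod_cast this
  · have hE : 𝔠.expansion ξ S (𝔠.coordS S c) ≠ 0 := by rw [← hform]; exact_mod_cast hm
    exact 𝔠.coords_mem_of_expansion_ne_zero ξ S _ hE

end ClassificationKit

end Summit.HodgeConjecture.HodgeConjecture.Cruxes.H413.F0P3InnerFormClassificationV8
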